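import Mathlib
import HarnessLib
import HarnessLib.Audit
import Summits.HodgeConjecture.HodgeConjecture.Statement
import Literature.AlgebraicGeometry.Motives.PeriodComparison

/-!
Route: AttractorPlanes

CLOSED (retired) 2026-08-15T13:48:11Z by operator:999:1257524 — reason: not-a-thesis: assembly does not conclude the sub-problem Statement — note: D-0027 §2.1 audit (human 2026-08-15: routes that do not decide the summit are removed): the assembly concludes `AttractorProjectorAlgebraic`, not the sub-problem statement; a NEW conforming route may be opened from the same idea (generated `closes : … → _root_.HodgeConjecture`).. The file is kept as the record of this route; refuted decls are indexed as negative knowledge (`ledger negatives`).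

Thesis X (idea card HodgeConjecture/HodgeConjecture/adelic-coherence-attractor-planes — "three
planes must be one"). TARGET of the route = the Hodge conjecture for RANK-2 ATTRACTOR PROJECTORS
(decl AttractorProjectorAlgebraic): for X smooth projective of dimension n over a field k ⊂ ℂ
ALGEBRAIC OVER ℚ (the situation of a rational rank-2 attractor point s₀ ∈ ℚ of a Calabi–Yau pencil,
CandelasEtAl2020 AESZ34 at s₀ = −1/7, BonischEtAl2024 §3.3 hypergeometric attractors; also singular
K3 / n = 2) and a rational 2-plane T ⊂ Hⁿ_B(X_σ, ℚ) with Fⁿ = H^{n,0} ⊂ T_ℂ and h^{n,0} = 1 (so T_ℂ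
= H^{n,0} ⊕ H^{0,n} and T is the UNIQUE such sub-Hodge structure), the projector onto T is induced
by an algebraic self-correspondence of X_σ with ℚ-coefficients. It suffices to show the conjunction
of
 (DeRhamPlane) ARCHIMEDEAN = DE RHAM: T_ℂ is the complexification, under Grothendieck's comparison
iso_σ, of a k-RATIONAL plane W ⊂ Hⁿ_dR(X/k) of algebraic de Rham cohomology — the de Rham component
of "π_T is absolute Hodge" (Deligne1982HodgeCycles Def. 2.10; CharlesSchnell2014Notes Conj. 11.2.17)
at an ISOLATED rational point of the Hodge locus, where it is a concrete identity: the ratios of the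
2×2 minors of the 2×3 attractor period matrix (∫_{δ_i}∇^jΩ(s₀)) lie in k; and
 (PlaneUpgrade) DE RHAM-RATIONAL ⇒ ALGEBRAIC: an attractor plane with a k-rational de Rham
incarnation is the image of an algebraic idempotent correspondence (CharlesSchnell2014Notes Conj.
11.2.18 restricted to attractor projectors).
The card's THIRD plane — for each good prime 𝔭 the crystalline-Frobenius-stable plane ker P_T(φ_𝔭) ⊂
Hⁿ_dR ⊗ k_𝔭 (Ogus1982 "absolutely Tate"; Blasius1994 proves the abelian-variety case) — is crux
FrobeniusPlane, filed informally after open (no crystalline Frobenius on algebraic de Rham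
cohomology exists in Literature yet; definition requested); it is the CERTIFIABLE p-adic twin of
DeRhamPlane (Dwork–Frobenius matrices of the Picard–Fuchs operator, SamolVanstraten2008) and the
intended extra hypothesis of PlaneUpgrade.
Lean: DeRhamPlane ∧ PlaneUpgrade — both ∀ ⦃k : Type⦄ [Field k] [CharZero k], Algebra.IsAlgebraic ℚ k
→ ∀ (σ : k →+* ℂ) (P : Literature.AlgebraicGeometry.Motives.PeriodRealization k) ⦃n⦄ ⦃X⦄,
IsSmoothProjective n X → ∀ hXσ (T : Submodule ℚ ((P.B.comap σ).obj X n)), Module.finrank ℚ T = 2 →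
(P.B.hodge hXσ n).F n ≤ T.baseChange ℂ → Module.finrank ℂ ((P.B.hodge hXσ n).F n) = 1 → …,
concluding ∃ W : Submodule k (P.dR.obj X n), iso σ X n (W ⊗ ℂ) = T ⊗ ℂ (via alongHomTensorEquiv, the
iso_fil spelling), resp. (∃ W …) → ∃ e, e ∘ₗ e = e ∧ LinearMap.range e = T ∧
P.B.W.IsAlgebraicOperator n n e. Every constant checked (lean search); all decls elaborate (folder
SketchFQ.lean, rc 0).

## Assembly
DeRhamPlane → PlaneUpgrade → AttractorProjectorAlgebraic, pointwise in (k, σ, P, X, T): modus ponens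
(kernel-checked, Sketch.lean `assembly_holds`, axioms propext/Classical.choice/Quot.sound).
AttractorProjectorAlgebraic is a special case of the summit: π_T ⊗ 1 is a rational (n,n)-class on
X_σ × X_σ (VoisinHodgeI2002 Lemma 11.41), so HodgeConjectureFor (2n-fold X_σ × X_σ, p = n) gives it
(support HodgeForcesTarget, informal: the B-layer proof needs the Künneth compatibility of
BettiHodgeData.hodge and the classical-datum bridge shared with route PeriodsPolice's
ClassicalBridge).

Rationale: WHY THIS LINE. The card imports ARITHMETIC GEOMETRY (absolute Hodge classes, Deligne1982HodgeCycles
§2; p-adic/crystalline comparison, BerthelotOgus1983, KatzMessing1974, Ogus1982, Blasius1994) and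
CERTIFIED NUMERICS of Calabi–Yau periods and Dwork–Frobenius matrices (CandelasEtAl2020,
BonischEtAl2024, SamolVanstraten2008, KachruNallyYang2024) into the one regime where the arithmetic
half of the Hodge conjecture is TESTABLE without Galois-transporting Betti classes: an isolated
RATIONAL point of the Hodge locus. There HC(X_σ × X_σ) predicts that three 2-planes computed in
three worlds — the complex Hodge plane H^{n,0} ⊕ H^{0,n}, the k-structure of algebraic de Rham
cohomology, and (for every good 𝔭) the φ_𝔭-stable plane — coincide (half-page lemma on the card:
cycle over ℚ̄ + Galois conjugates of an idempotent preserving the k-rational line Fⁿ = kΩ have image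
the unique rank-2 sub-HS ∋ H^{n,0}; support HodgeForcesTarget/HodgeForcesDeRhamPlane).
Positive-dimensional Hodge loci are handled by monodromy (Voisin2007HodgeLoci,
KlinglerOtwinowskaUrbanik2023, Urbanik2022 Thm 1.3/1.7 READ arXiv:2011.10703 pp.2–5: needs Z ∋ s
with algebraic monodromy whose normaliser fixes the class); at an ISOLATED point monodromy is
trivial and nothing is known — this route stakes the isolated-point case as two typed cruxes over
the tree's PeriodRealization layer plus the crystalline twin, with the target (HC for attractor
projectors) assembled by modus ponens. Catalogue used: arithmetisation/adelisation (item 19),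
certified computation (item 17) as evidence channel; no physical analogy is load-bearing
(attractor/flux-vacuum tables are only a census of test points).
RANKED CRUXES. #2 DeRhamPlane — at every rank-2 attractor plane T (k ⊂ ℂ algebraic over ℚ, h^{n,0} =
1, Fⁿ ⊂ T_ℂ, rank T = 2) the Hodge plane is the complexification of a k-plane of Hⁿ_dR(X/k) (why it
might fail: it is absolute-Hodge-for-π_T off abelian type; one transcendental ratio of attractor
period minors refutes it and HC with it; sources CharlesSchnell2014Notes §11.2.5,
Voisin2007HodgeLoci, Urbanik2022, BonischEtAl2024 §3.3). #3 PlaneUpgrade — a de Rham-rational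
attractor plane is the range of an algebraic idempotent (why it might fail: 'absolute Hodge ⇒
algebraic' has no engine off abelian type, Andre1996Motifs needs motivated + B(X); as typed it omits
the crystalline hypothesis, so a de Rham-rational non-motivic plane — a
Grothendieck-period-conjecture-type accident — refutes it without touching HC; sources
CharlesSchnell2014Notes Conj. 11.2.18, Deligne1982HodgeCycles, CandelasEtAl2020 §4 modularity as the
only foreseeable handle). #4 FrobeniusPlane (informal, filed after open; needs definition
CrystallineFrobeniusDatum) — W ⊗ k_𝔭 is φ_𝔭-stable at every good 𝔭, = ker P_T(φ_𝔭) when the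
Frobenius factors are coprime (why it might fail: = Ogus's 'absolutely Tate' for π_T, known only on
abelian varieties, Blasius1994, Ogus1982 §4; a p-dependent φ-stable plane at one good prime refutes
it; sources Ogus1982, Blasius1994, CandelasEtAl2020 §3, SamolVanstraten2008).
KILL CRITERIA. (a) A certified transcendence/irrationality of one period-minor ratio at a rational
attractor, or a PROOF that ker P_T(φ_p) is not the reduction of a common k-plane for two good
primes, refutes DeRhamPlane/FrobeniusPlane and thereby HC for the 2n-fold X_σ × X_σ: route closes
'refuted' and the negatives index gains the first Hodge counterexample candidate (numerics alone
cannot do this — weak approximation: rational planes are dense in every finite set of completions —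
unless the companion card g-function-northcott-isolated-hodge-points supplies a height bound). (b)
PlaneUpgrade refuted by an exotic PeriodRealization (see DEGENERATE CASES) forces a restate under
the classicality predicate, not a close. (c) If DeRhamPlane is PROVED in general the route has done
its job even if PlaneUpgrade stalls: pivot to the complementary construction (card
attractor-jump-abel-jacobi-splitting: cylinder map for T^c) as a new route sharing the target.
NOT DECOMPOSED YET. The ℚ- vs ℚ̄-descent step (Galois averaging of the idempotent) inside
HodgeForcesDeRhamPlane; the split of PlaneUpgrade into 'de Rham + crystalline coherent ⇒ motivated'
and 'motivated ⇒ algebraic (B for X×X)'; the modular identification T ↔ weight-(n+1) newform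
(CandelasEtAl2020 §4) that would turn recognition of the rational plane into verification (Deligne
periods); flux-vacuum planes of type (2,1)+(1,2) (KachruNallyYang2024; uniqueness fails, only
ℚ̄-rationality is predicted); CY fourfold (2,2)-classes; the certified-numerics protocol itself (kit
job: Arb periods + PSLQ on minors; Dwork matrices mod p^N for p = 11, 13, 17) which lands as
EVIDENCE on DeRhamPlane/FrobeniusPlane, never as an item.
CHEAPEST FALSIFIER. One kit job at AESZ34, s₀ = −1/7 (CandelasEtAl2020) or at BonischEtAl2024's two
hypergeometric rank-2 attractors where the integer matrices A, B are printed: PSLQ at 100 digits on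
the ratios of the three 2×2 minors of (∫_{δ_i}∇^jΩ(s₀))_{i=1,2; j=1,2,3} — no rational relation of
height ≤ 10^12 is strong evidence against DeRhamPlane; then ker P_T(U_p(s₀)) from the
Dwork–Frobenius matrix for p = 11, 13, 17: Plücker coordinates must be the SAME rationals. Known
theorem that kills a crux as typed: none found (searches in NOVELTY).
TWO-LAYER PLAN. Layer 1 = DeRhamPlane, PlaneUpgrade (+ FrobeniusPlane informal), target, assembly,
supports. Foreseen glued splits (depth 1, k ≤ 3), only after a crux closes: PlaneUpgrade ⇐
(CoherentImpliesMotivated: de Rham + Frobenius coherent attractor planes are cut out by motivated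
correspondences) → (LefschetzBForSquare: B(X_σ × X_σ), shared decl with route PeriodsPolice's
LefschetzB) → PlaneUpgrade; DeRhamPlane ⇐ (GaloisSplitting: Faltings–Serre splitting of Hⁿ_et at the
attractor) → (SplitImpliesDeRhamRational: ℓ-adic splitting + Fontaine comparison ⇒ one k-plane; the
card's A3) → DeRhamPlane.
DEFINITION REQUESTS. CrystallineFrobeniusDatum (Literature/AlgebraicGeometry/Motives): for P :
PeriodRealization k, k a number field, X smooth projective with good reduction at a finite place v,
the k_v-linear Frobenius φ_v on P.dR.obj X i ⊗ k_v transported from H^i_cris by Berthelot–Ogus, with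
φ_v(cl_dR Z) = q_v^{codim Z} cl_dR Z (Gillet–Messing) and charpoly = that of geometric Frobenius on
H^i_et (KatzMessing1974) — hypothesis structure + separate existence statement, as for
PeriodRealization itself. Also wanted (shared with PeriodsPolice stmt-HodgeConjecture-1202): the
classicality predicate PeriodRealization.IsClassical pinning P.B.hodge to the true Hodge filtration;
once it lands every item here should be restated with `P.IsClassical →`.
SUPPORT. AttractorPlaneSubHodge (provable now, linear algebra: rank 2 + Fⁿ ⊂ T_ℂ + h^{n,0} = 1 ⇒ T
is a SubHodgeStructure); SurfaceCase (n = 2: the target for surfaces with p_g = 1, ρ = b₂ − 2 —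
singular K3, singular abelian surfaces — is Lefschetz (1,1) + algebraicity of the Künneth projector
π₂ of a surface, Kleiman1968 §2; a theorem in print, formally L); HodgeForcesTarget and
HodgeForcesDeRhamPlane (informal, filed after open: HC(X_σ × X_σ) ⇒ target, resp. ⇒ DeRhamPlane via
Galois averaging — the wiring that makes a refutation of #2/#4 bite on the summit).
DEGENERATE CASES CHECKED. (i) n = 2: every statement is a theorem in print (Lefschetz (1,1)); filed
as SurfaceCase, a sanity anchor. (ii) Hypothesis-structure caveat (shared by every B/P-layer
statement, PROBLEMS.md §1 note; CohomologicalPeriods 'twisted model'): items quantify over ALL P :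
PeriodRealization k; Deligne-torus twists z^{q−p} of the comparison preserve T_ℂ and algebraicity,
so they do not break any item; a fake Hodge filtration on Hⁿ(X_σ) could manufacture a fake
'attractor' only together with a k-rational fake Fⁿ-line inside a rational Betti plane, i.e. a
genuine unexpected period relation on X over a field algebraic over ℚ (this is WHY k is restricted
to Algebra.IsAlgebraic ℚ k: over k = ℂ fake attractors would be free); no exotic P is constructible
in the tree (no Weil cohomology is constructed), so the loophole is theoretical; restate under
IsClassical when available. (iii) 'range e = T ∧ e idempotent ∧ algebraic' vs 'the orthogonal
projector π_T is algebraic': equivalent when ker e is non-degenerate (π_T = polynomial in e ∘ ᵗe,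
transposes of algebraic operators are algebraic, Kleiman1968 §1.3) and implied by HC in general.
(iv) Vacuity: the binder Algebra.IsAlgebraic ℚ k is inhabited (k = ℚ, number fields,
AlgebraicClosure ℚ); hXσ is supplied, not derived from the unproved fact
IsSmoothProjective.baseChangeHom, so no unproved named fact enters the cone.

Novelty: SEARCHED 2026-08-15 (this planner; searchd/galaxy rc 75 or queue-timeout twice, arXiv/OpenAlex HTTP
429 — recorded in NOTES.md; crossref leg worked): crossref 'Voisin Hodge loci and absolute Hodge
classes' (→ Voisin2007HodgeLoci, CharlesSchnell2014Notes, Voisin 2025 JOMP survey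
doi:10.56994/jomp.001.001.002 = acq-02104, not readable), crossref 'fields of definition of Hodge
loci Klingler Otwinowska Urbanik' (→ KlinglerOtwinowskaUrbanik2023, Saito–Schnell 2016
doi:10.1017/cbo9781316387887.012, Urbanik2022 doi:10.1112/s0010437x2200745x), lit read
arXiv:2011.10703 (Urbanik2022, READ pp.2–5: Def. 1.1 'rational conjugates' in de Rham AND ℓ-adic
realisations, Thm 1.3/Cor 1.4/Thm 1.7 — absolute Hodge from the algebraic monodromy of a subvariety
Z ∋ s whose normaliser fixes the class; Claim 1.6 — a ℚ̄-point that is ℚ_ℓ-rational for all ℓ is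
ℚ-rational; Thm 1.9 generic Hodge isomorphisms), crossref for the numerics (→ CandelasEtAl2020
doi:10.1007/jhep10(2020)202, BonischEtAl2024 doi:10.1007/s00220-024-05006-6, KachruNallyYang2024,
SamolVanstraten2008); plus the card's two refuter audits (BKSZ §3.3 READ: integer matrices A, B =
numerical (P_dR)+(P_∞); CdOEvS §1.3/§4; CdOvS arXiv:2104.07816 grep; zbMATH → Golyshev–van Straten
acq-01863) and the tree (Literature/Barriers/HodgeConjecture/AbsoluteHodgeClasses,
Motives/PeriodComparison, ComparisonAbsolute).
NEAREST PRIOR ART: (1) CharlesSchnell2014Notes Conj. 11.2.17 + 11.2.18 and Thm 11.3.17/Cor 11.3.18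
(absolute Hodge ⟺ Hodge-locus compon  [refs: 10.56994/jomp.001.001.002, 10.1017/cbo9781316387887.012, 10.1112/s0010437x2200745x, 10.1007/jhep10(2020, 10.1007/s00220-024-05006-6, 2011.10703, 2104.07816, doi:10.56994/jomp.001.001.002, doi:10.1017/cbo9781316387887.012, doi:10.1112/s0010437x2200745x, doi:10.1007/jhep10, doi:10.1007/s00220-024-05006-6, KlinglerOtwinowskaUrbanik2023, Urbanik2022, CandelasEtAl2020, BonischEtAl2024, KachruNallyYang2]

Barriers (technique_class: absolute-hodge, crystalline-comparison, period-numerics): - technique_class: absolute-hodge, field-of-definition-of-hodge-loci, crystalline-comparison,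
period-relations, certified-numerics, correspondences
- Literature.Barriers.HodgeConjecture.hodgeClassesAreAbsoluteFor_abelianVariety: on abelian
varieties DeRhamPlane-type statements are Deligne's theorem (and FrobeniusPlane is
Blasius1994/Ogus1982), so the cruxes carry no information there; the route's test points (CY3
pencils with Sp(4) monodromy, X_σ × X_σ) are not of abelian type, and for n = 2 (K3/abelian
surfaces, abelian type) the statements are theorems filed as the sanity support SurfaceCase — the
barrier bounds WHERE the route is informative, it does not block it; by its corollary in the same
file (no non-absolute Hodge class exists on an abelian variety) a refutation of DeRhamPlane can only
come from a non-abelian-type attractor, which is exactly where the card's census lives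
(CandelasEtAl2020, BonischEtAl2024, KachruNallyYang2024 tables).
- Literature.Barriers.HodgeConjecture.CattaniDeligneKaplan1995_hodgeLocus_algebraicFor: algebraicity
of the Hodge locus is trivial for an isolated point; the content tested is the field of definition
of the CLASS (de Rham rationality), the evasion the catalogue itself lists (Voisin2007HodgeLoci,
CharlesSchnell2014Notes Thm 11.3.17).
- Literature.Barriers.HodgeConjecture.Serre1964_conjugateVarieties_notHomeomorphic: no Betti class
is transported along Aut(ℂ); only the algebraic de Rham k-structure (and, informally, crystalline
Frobenius)

Novelty grade: new-combination — ROUTE REVIEW (refuter rreview-ab8e18b7, 2026-08-15; FIRST pass, I stamped 6/6 typed items and attached a sorry-free proof of Assembly 2316; 2415/2458/2489 informal). PRECISION: 6/6 elaborate (W4.lean rc0); DeRhamPlane's conclusion spelled exactly like axiom iso_fil; iso bijective ⇒ W unique. INTERFA (refuter refuter-rreview-route-PneNP-RamseyAliens-ab8e18b7-0, 2026-08-15T12:20:33Z; prior: Deligne1982HodgeCycles,CharlesSchnell2014Notes,Voisin2007HodgeLoci,doi:10.1112/s0010437x2200745x,KlinglerOtwinowskaUrbanik2023,doi:10.1007/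jhep10(2020)202,doi:10.1007/s00220-024-05006-6,Ogus1982,Blasius1994,Andre1996Motifs,Kleiman1968)

History (route lifecycle, newest last):
- 2026-08-15T13:48:11Z · CLOSED retired — not-a-thesis: assembly does not conclude the sub-problem Statement (operator:999:1257524)

sub-problem: HodgeConjecture · status: closed(retired) · opened planner-plancard-HodgeConjecture-HodgeConject-06f74e71-0 2026-08-15T11:03:04Z · rev 1 · ledger route-HodgeConjecture-AttractorPlanes
GENERATED by the gate from the ledger (D-0016/17). Provers cite these decls: `theorem foo : Summit.HodgeConjecture.HodgeConjecture.Theses.AttractorPlanes.<Decl> := …` in Summits/HodgeConjecture/HodgeConjecture/Theorems/<Name>.lean.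
-/

namespace Summit.HodgeConjecture.HodgeConjecture.Theses.AttractorPlanes

open scoped BigOperators Topology Manifold Classical MeasureTheory ProbabilityTheory Matrix InnerProductSpace ComplexConjugate ContinuousMap
open Filter Set Function TopologicalSpace MeasureTheory

attribute [summit_statement] _root_.HodgeConjecture

/-- item stmt-HodgeConjecture-2311 · target · rank 0 · closed · moot by None · by planner
why it might fail: = HC for the (n,n) Künneth-type class π_T⊗1 on the 2n-fold X_σ×X_σ, X Calabi–Yau, outside abelian type and every proven case (n = 2: Lefschetz (1,1) + π₂ algebraic); nothing known for n ≥ 3, and as typed (∀ P : PeriodRealization) no instance-specific input (modularity, cylinder maps) is available.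
sources: Deligne2000, VoisinHodgeI2002, CandelasEtAl2020, BonischEtAl2024, Kleiman1968
[target] HODGE CONJECTURE FOR RANK-2 ATTRACTOR PROJECTORS: for k a field of characteristic 0
ALGEBRAIC OVER ℚ, σ : k →+* ℂ, P a period realization over k (tree PeriodComparison: algebraic de
Rham P.dR, Betti–Hodge data P.B, Grothendieck comparison P.iso σ), X/k smooth projective of
dimension n and T ≤ Hⁿ_B(X_σ, ℚ) a rational plane of rank 2 with Fⁿ = (P.B.hodge hXσ n).F n ⊂ T_ℂ
and dim_ℂ Fⁿ = 1 (a RANK-2 ATTRACTOR PLANE: T_ℂ = H^{n,0} ⊕ H^{0,n}, the unique such sub-Hodge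
structure — support AttractorPlaneSubHodge), T is the range of an idempotent e : Hⁿ_B(X_σ) →ₗ[ℚ]
Hⁿ_B(X_σ) induced by a codimension-n algebraic cycle on X_σ × X_σ with ℚ-coefficients
(P.B.W.IsAlgebraicOperator n n e, Kleiman1968 §1.4). Special case of the summit: π_T ⊗ 1 ∈ Hⁿ ⊗ Hⁿ ⊂
H²ⁿ(X_σ × X_σ, ℚ) is a rational (n,n)-class (VoisinHodgeI2002 Lemma 11.41), so HodgeConjectureFor
for the 2n-fold X_σ × X_σ in codimension n yields it (support HodgeForcesTarget, informal).
Instances: AESZ34 at s₀ = −1/7 and 33 ± 8√17 (CandelasEtAl2020), the hypergeometric attractors of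
BonischEtAl2024 §3.3, singular K3 / singular abelian surfaces (n = 2, a theorem: support
SurfaceCase). Why it might fail: it is HC for a (3,3)-class on -/
@[route_item "route-HodgeConjecture-AttractorPlanes"]
def AttractorProjectorAlgebraic : Prop :=
  ∀ ⦃k : Type⦄ [Field k] [CharZero k], Algebra.IsAlgebraic ℚ k → ∀ (σ : k →+* ℂ) (P : Literature.AlgebraicGeometry.Motives.PeriodRealization k) ⦃n : ℕ⦄ ⦃X : Literature.AlgebraicGeometry.Motives.SchemeOver k⦄, Literature.AlgebraicGeometry.Motives.IsSmoothProjective n X → ∀ (hXσ : Literature.AlgebraicGeometry.Motives.IsSmoothProjective n ((Literature.AlgebraicGeometry.Motives.baseChangeHom σ).obj X)) (T : Submodule ℚ ((P.B.comap σ).obj X n)), Module.finrank ℚ T = 2 → (P.B.hodge hXσ n).F n ≤ T.baseChange ℂ → Module.finrank ℂ ((P.B.hodge hXσ n).F n) = 1 → ∃ e : (P.B.comap σ).obj X n →ₗ[ℚ] (P.B.comap σ).obj X n, e ∘ₗ e = e ∧ LinearMap.range e = T ∧ P.B.W.IsAlgebraicOperator n n (X := (Literature.AlgebraicGeometry.Motives.baseChangeHom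 σ).obj X) (Y := (Literature.AlgebraicGeometry.Motives.baseChangeHom σ).obj X) e

/-- item stmt-HodgeConjecture-2312 · crux · rank 2 · closed · moot by None · by planner
why it might fail: = de Rham part of 'π_T absolute Hodge' at an ISOLATED Hodge-locus point, open off abelian type (CharlesSchnell Conj 11.2.17; Voisin2007/KOU2023/Urbanik2022 need dim Z>0): one irrational ratio of 2×2 period minors at a rational CY3 attractor refutes it and HC; no engine over the bare ∀-P interface.
sources: CharlesSchnell2014Notes, Deligne1982HodgeCycles, Voisin2007HodgeLoci, Urbanik2022, arXiv:2011.10703, KlinglerOtwinowskaUrbanik2023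
[crux] ARCHIMEDEAN PLANE = DE RHAM PLANE (card (P_dR)+(P_∞); the de Rham component of 'π_T is
absolute Hodge', Deligne1982HodgeCycles Def. 2.10 / CharlesSchnell2014Notes Conj. 11.2.17, at an
ISOLATED rational point of the Hodge locus). Setting as in the target (k algebraic over ℚ, σ, P, X/k
smooth projective of dim n, T a rank-2 attractor plane of Hⁿ_B(X_σ)). CLAIM: ∃ a k-subspace W ≤
Hⁿ_dR(X/k) = P.dR.obj X n with iso_σ(W ⊗_k ℂ) = T ⊗_ℚ ℂ (spelled exactly like the axiom
PeriodRealization.iso_fil: base change along AlongHom ℂ σ, map by P.iso σ X n, restrictScalars ℚ,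
transport by alongHomTensorEquiv). The line kΩ = P.dR.fil n n already accounts for H^{n,0}
(iso_fil), so the content is ONE more de Rham vector: at a rational rank-2 attractor of a CY3
pencil, in the ℚ-basis ∇^jΩ(s₀) of H³_dR, the point (a:b:c) ∈ P² with a∇Ω + b∇²Ω + c∇³Ω ∈ T_ℂ is
k-RATIONAL — equivalently the ratios of the 2×2 minors of the 2×3 period matrix (∫_{δ_i}∇^jΩ(s₀)),
δ₁, δ₂ spanning T^⊥ ⊂ H₃(X,ℤ), lie in k (k = ℚ when s₀ ∈ ℚ). HC(X_σ × X_σ) implies it (support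
HodgeForcesDeRhamPlane, informal: cycle over ℚ̄; every Galois conjugate of the idempotent fixes the
k-rational line Fⁿ, so its image is the unique ran -/
@[route_item "route-HodgeConjecture-AttractorPlanes"]
def DeRhamPlane : Prop :=
  ∀ ⦃k : Type⦄ [Field k] [CharZero k], Algebra.IsAlgebraic ℚ k → ∀ (σ : k →+* ℂ) (P : Literature.AlgebraicGeometry.Motives.PeriodRealization k) ⦃n : ℕ⦄ ⦃X : Literature.AlgebraicGeometry.Motives.SchemeOver k⦄, Literature.AlgebraicGeometry.Motives.IsSmoothProjective n X → ∀ (hXσ : Literature.AlgebraicGeometry.Motives.IsSmoothProjective n ((Literature.AlgebraicGeometry.Motives.baseChangeHom σ).obj X)) (T : Submodule ℚ ((P.B.comap σ).obj X n)), Module.finrank ℚ T = 2 → (P.B.hodge hXσ n).F n ≤ T.baseChange ℂ → Module.finrank ℂ ((P.B.hodge hXσ n).F n) = 1 → ∃ W : Submodule k (P.dR.obj X n), (((W.baseChange (Literature.AlgebraicGeometry.Motives.AlongHom ℂ σ)).map (P.iso σ X n)).restrictScalars ℚ).map (Literature.AlgebraicGeometry.Motives.alongHomTensorEquiv σ ((P.B.comap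 σ).obj X n)).toLinearMap = (T.baseChange ℂ).restrictScalars ℚ

/-- item stmt-HodgeConjecture-2313 · crux · rank 3 · closed · moot by None · by planner
why it might fail: 'Absolute Hodge ⇒ algebraic' (CharlesSchnell Conj 11.2.18) has no engine off abelian type (Andre1996Motifs: motivated + B(X)); as typed the hypothesis is de Rham rationality along ONE σ for arbitrary P, so a de Rham-rational non-motivic plane (period-conjecture failure, exotic P) kills it, not HC.
sources: CharlesSchnell2014Notes, Andre1996Motifs, Deligne1982HodgeCycles, Ogus1982, CandelasEtAl2020, Kleiman1968
[crux] DE RHAM-RATIONAL ATTRACTOR PLANE ⇒ ALGEBRAIC PROJECTOR (CharlesSchnell2014Notes Conj. 11.2.18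
'absolute Hodge classes are algebraic', restricted to rank-2 attractor projectors). Same setting;
hypothesis = the conclusion of DeRhamPlane at (k, σ, P, X, T) (∃ k-rational de Rham plane W with
iso_σ(W_ℂ) = T_ℂ); CLAIM: ∃ e : Hⁿ_B(X_σ) →ₗ[ℚ] Hⁿ_B(X_σ) with e ∘ e = e, range e = T and
P.B.W.IsAlgebraicOperator n n e. The orthogonal projector π_T itself follows whenever ker e is
non-degenerate (π_T is a polynomial in e ∘ ᵗe; transposes and composites of algebraic operators are
algebraic, Kleiman1968 §1.3, tree isAlgebraicGradedOp_transpose/comp). INTENDED hypothesis is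
coherence in ALL realisations: once the definition CrystallineFrobeniusDatum lands, a tenure restate
adds FrobeniusPlane's φ_𝔭-stability of W ⊗ k_𝔭 at almost all 𝔭, turning the item into 'absolutely
Hodge-and-Tate attractor planes are motivic/algebraic' (Ogus1982 §4); as typed it is STRONGER (de
Rham coherence alone). Engines: none general off abelian type (Andre1996Motifs Thm 0.4/0.6.2:
motivated ⇒ algebraic needs B(X); Deligne1982HodgeCycles needs abelian type); specific handles:
modularity T ↔ weight-(n+1) newform re -/
@[route_item "route-HodgeConjecture-AttractorPlanes"]
def PlaneUpgrade : Prop :=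
  ∀ ⦃k : Type⦄ [Field k] [CharZero k], Algebra.IsAlgebraic ℚ k → ∀ (σ : k →+* ℂ) (P : Literature.AlgebraicGeometry.Motives.PeriodRealization k) ⦃n : ℕ⦄ ⦃X : Literature.AlgebraicGeometry.Motives.SchemeOver k⦄, Literature.AlgebraicGeometry.Motives.IsSmoothProjective n X → ∀ (hXσ : Literature.AlgebraicGeometry.Motives.IsSmoothProjective n ((Literature.AlgebraicGeometry.Motives.baseChangeHom σ).obj X)) (T : Submodule ℚ ((P.B.comap σ).obj X n)), Module.finrank ℚ T = 2 → (P.B.hodge hXσ n).F n ≤ T.baseChange ℂ → Module.finrank ℂ ((P.B.hodge hXσ n).F n) = 1 → (∃ W : Submodule k (P.dR.obj X n), (((W.baseChange (Literature.AlgebraicGeometry.Motives.AlongHom ℂ σ)).map (P.iso σ X n)).restrictScalars ℚ).map (Literature.AlgebraicGeometry.Motives.alongHomTensorEquiv σ ((P.B.comap σ).obj X n)).toLinearMap = (T.baseChange ℂ).restrictScalars ℚ) → ∃ e : (P.B.comap σ).obj X n →ₗ[ℚ] (P.B.comap σ).obj X n, e ∘ₗ e = e ∧ LinearMap.range e = T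 ∧ P.B.W.IsAlgebraicOperator n n (X := (Literature.AlgebraicGeometry.Motives.baseChangeHom σ).obj X) (Y := (Literature.AlgebraicGeometry.Motives.baseChangeHom σ).obj X) e

-- item stmt-HodgeConjecture-2415 · crux · rank 4 · closed · moot by None · by planner — informal only, no Lean statement yet:
--   [crux] THE THIRD PLANE — CRYSTALLINE FROBENIUS (card (P_p); informal until the definition
--   CrystallineFrobeniusDatum lands, then set-signature). Setting: k a NUMBER FIELD, σ : k →+* ℂ, P a
--   period realization over k, X/k smooth projective of dimension n with good reduction at a finite
--   place v of k (residue field 𝔽_q, q = p^f, p > n or p unramified in k as Berthelot–Ogus/Katz–Messing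
--   require), T ≤ Hⁿ_B(X_σ, ℚ) a rank-2 attractor plane (Fⁿ ⊂ T_ℂ, h^{n,0} = 1) and W ≤ Hⁿ_dR(X/k) its
--   k-rational de Rham plane (the conclusion of DeRhamPlane). CLAIM: the k_v-linear crystalline
--   Frobenius φ_v of Hⁿ_dR(X/

/-- item stmt-HodgeConjecture-2314 · support · rank 9 · closed · moot by None · by planner
sources: VoisinHodgeI2002, Deligne1971
[support] PROVABLE NOW (linear algebra, ~150 lines): for a ℚ-Hodge structure H = P.B.hodge hXσ n of
weight n on V = Hⁿ_B(X_σ) and a rational plane T ≤ V of rank 2 with Fⁿ ≤ T_ℂ and dim_ℂ Fⁿ = 1, T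
underlies a sub-Hodge structure (∃ S : HodgeStructure.SubHodgeStructure H, S.toSubmodule = T).
Proof: Fⁿ is one line, hence a single Hodge piece V^{p₀,q₀} (p₀ ≥ n); T_ℂ is conj-stable (T
rational) and contains Fⁿ ⊕ conj Fⁿ (Fⁿ ∩ conj Fⁿ ≤ Fⁿ ∩ conj F¹ = 0 by isCompl_F_complexConj n 1
and antitone_F, n ≥ 1; n = 0 degenerate but true), so by rank T_ℂ = V^{p₀,q₀} ⊕ V^{q₀,p₀}, a sum of
pieces, and the induced filtration is n-opposed (check SubHodgeStructure.isCompl piecewise; may need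
the decomposition lemmas HodgeStructure.iSup_piece_eq_top / iSupIndep_piece — if those are unproved
named facts in the tree, prove the rank-2 case directly). Justifies the words 'rank-2 attractor
plane = sub-HS of type (p₀,q₀)+(q₀,p₀)' used by every item. Sources: VoisinHodgeI2002 §7.3.1 Def.
7.24; Deligne1971 (Hodge II) 1.2.5. [difficulty: provable-now] -/
@[route_item "route-HodgeConjecture-AttractorPlanes"]
def AttractorPlaneSubHodge : Prop :=
  ∀ ⦃k : Type⦄ [Field k] [CharZero k] (σ : k →+* ℂ) (P : Literature.AlgebraicGeometry.Motives.PeriodRealization k) ⦃n : ℕ⦄ ⦃X : Literature.AlgebraicGeometry.Motives.SchemeOver k⦄ (hXσ : Literature.AlgebraicGeometry.Motives.IsSmoothProjective n ((Literature.AlgebraicGeometry.Motives.baseChangeHom σ).obj X)) (T : Submodule ℚ ((P.B.comap σ).obj X n)), Module.finrank ℚ T = 2 → (P.B.hodge hXσ n).F n ≤ T.baseChange ℂ → Module.finrank ℂ ((P.B.hodge hXσ n).F n) = 1 → ∃ S : Literature.AlgebraicGeometry.Motives.HodgeStructure.SubHodgeStructure (P.B.hodge hXσ n), S.toSubmodule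 = T

/-- item stmt-HodgeConjecture-2315 · support · rank 9 · closed · moot by None · by planner
sources: Kleiman1968, Murre2004LecturesMotives, VoisinHodgeI2002
[support] THE SURFACE CASE n = 2 of the target (sanity anchor; a theorem in print, literal
specialisation n := 2 of AttractorProjectorAlgebraic — Sketch.lean surfaceCase_of_target): X/k a
smooth projective surface, T ≤ H²_B(X_σ, ℚ) a rational plane containing F² = H^{2,0} with p_g = 1 (⟺
ρ(X_σ) = b₂ − 2 and T = transcendental lattice ⊗ ℚ: singular K3 surfaces, singular abelian
surfaces). Then an algebraic idempotent with range T exists: π_T = π₂ − π_{NS}, π_{NS} = Σ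
(M⁻¹)_{ij} [D_i × D_j] algebraic by Lefschetz (1,1) (divisor classes; tree LefschetzOneOne on the
real layer, B-layer via cycleClass of divisors and cup products), and the Künneth projector π₂ of a
surface is algebraic (Kleiman1968 §2: B(X), hence C(X), holds for surfaces; Murre's Chow–Künneth
decomposition, Murre2004LecturesMotives). Formally L in the B-layer: needs the Künneth/Poincaré
bookkeeping of WeilCohomology (IsInducedBy, ratAlgebraicClasses of X_σ ⊗ X_σ) and Lefschetz (1,1)
for P.B (add it as an explicit hypothesis in the Theorems file if it is not derivable from
BettiHodgeData's axioms; the item stays meaningful). Sources: Kleiman1968 §2;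
Murre2004LecturesMotives §4; VoisinHodgeI2002 §11.3. [difficulty: L] -/
@[route_item "route-HodgeConjecture-AttractorPlanes"]
def SurfaceCase : Prop :=
  ∀ ⦃k : Type⦄ [Field k] [CharZero k], Algebra.IsAlgebraic ℚ k → ∀ (σ : k →+* ℂ) (P : Literature.AlgebraicGeometry.Motives.PeriodRealization k) ⦃X : Literature.AlgebraicGeometry.Motives.SchemeOver k⦄, Literature.AlgebraicGeometry.Motives.IsSmoothProjective 2 X → ∀ (hXσ : Literature.AlgebraicGeometry.Motives.IsSmoothProjective 2 ((Literature.AlgebraicGeometry.Motives.baseChangeHom σ).obj X)) (T : Submodule ℚ ((P.B.comap σ).obj X 2)), Module.finrank ℚ T = 2 → (P.B.hodge hXσ 2).F 2 ≤ T.baseChange ℂ → Module.finrank ℂ ((P.B.hodge hXσ 2).F 2) = 1 → ∃ e : (P.B.comap σ).obj X 2 →ₗ[ℚ] (P.B.comap σ).obj X 2, e ∘ₗ e = e ∧ LinearMap.range e = T ∧ P.B.W.IsAlgebraicOperator 2 2 (X := (Literature.AlgebraicGeometry.Motives.baseChangeHom σ).obj X) (Y := (Literature.AlgebraicGeometry.Motives.baseChangeHom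 σ).obj X) e

-- item stmt-HodgeConjecture-2458 · support · rank 9 · closed · moot by None · by planner — informal only, no Lean statement yet:
--   [support] THE CARD'S LEMMA — HC ⇒ THREE PLANES ARE ONE (de Rham part): the Hodge conjecture for the
--   2n-fold X_σ × X_σ in codimension n implies the conclusion of DeRhamPlane at (k, σ, P, X, T), k
--   ALGEBRAIC OVER ℚ. Half-page proof (mathematically known, Charles–Schnell style;
--   CharlesSchnell2014Notes §11.2.5, Deligne1982HodgeCycles Ex. 2.1(a)): π_T ⊗ 1 is a rational
--   (n,n)-class on X_σ × X_σ, hence π_T = [Z]^* for a ℚ-cycle Z which may be taken over a finite Galois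
--   extension k′/k (cycles on X_ℂ × X_ℂ are homologically equivalent to k̄-cycles: spread out and
--   specialise; X is defined over k). For τ

-- item stmt-HodgeConjecture-2489 · support · rank 9 · closed · moot by None · by planner — informal only, no Lean statement yet:
--   [support] THE TARGET IS A SPECIAL CASE OF THE SUMMIT: HodgeConjecture (real layer:
--   Literature.AlgebraicGeometry.HodgeTheory.HodgeConjectureFor (2n) (X_σ × X_σ)) ⇒
--   AttractorProjectorAlgebraic at (k, σ, P, X, T) for the CLASSICAL period realization P. Mathematics
--   (one paragraph): T ≤ Hⁿ_B(X_σ, ℚ) is a sub-Hodge structure (AttractorPlaneSubHodge), T^⊥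
--   (cup-orthogonal) another, V = T ⊕ T^⊥; the projector π_T : V → V is a morphism of Hodge structures,
--   so under Künneth ⊗ Poincaré duality its class Π = Σ_i t_i ⊗ t_i^∨ ∈ Hⁿ ⊗ Hⁿ ⊂ H²ⁿ(X_σ × X_σ, ℚ) is a
--   rational class of type (n,n) (VoisinHodgeI2002 L

/-- item stmt-HodgeConjecture-2316 · assembly · rank 1 · closed · moot by None · by planner
sources: CharlesSchnell2014Notes
[assembly] DeRhamPlane → PlaneUpgrade → AttractorProjectorAlgebraic: instantiate both cruxes at (k,
σ, P, X, T) and compose (modus ponens; kernel-checked in the planner's Sketch.lean `assembly_holds`,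
axioms propext/Classical.choice/Quot.sound). No mathematics; the informal crux FrobeniusPlane enters
only after PlaneUpgrade is restated with the crystalline hypothesis (tenure). -/
@[route_item "route-HodgeConjecture-AttractorPlanes"]
def Assembly : Prop :=
  DeRhamPlane → PlaneUpgrade → AttractorProjectorAlgebraic

end Summit.HodgeConjecture.HodgeConjecture.Theses.AttractorPlanes
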